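import Summits.NavierStokesRegularity.NavierStokesRegularity.Theorems.QuantisedSymmetryPolyhedralDssProfileExistsStubTraceWeakLimit
import Summits.NavierStokesRegularity.NavierStokesRegularity.Theorems.QuantisedSymmetryPolyhedralDssProfileExistsStubTraceC1
import Literature.Analysis.FluidPDE.NewtonPotentialHolder
import HarnessLib

/-!
# No energy concentration at the singular time — crux stmt-NavierStokesRegularity-1404
  (`QuantisedSymmetry.PolyhedralDssProfileExists`), line polyhedral_cell,
  stub stub_noEnergyConcentration (N35)

Registered stub `stub_noEnergyConcentration` (`--supports stmt-NavierStokesRegularity-1404`): for a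
Type-I ancient mild field `V` in the Oseen gauge (`IsTypeIAncientMild C V`) with `HasTypeIDecay C₀ V`
and its pointwise blow-up-time trace `V₀` off the origin (`V(t, x) → V₀(x)` as `t ↑ 0`, `x ≠ 0`),
for every `r > 0`:

* `∫_{B_r} ‖V(t) − V₀‖² → 0` as `t ↑ 0` (strong `L²_loc` convergence of the slices to the scar);
* `‖V₀‖² ∈ L¹(B_r)`;
* the space–time dissipation near the singular point is finite, `∫_{−r²}^{0}∫_{B_r} ‖DV‖² < ∞`.

Proof sketch (folklore; dominated convergence and Tonelli).
* `‖V(t, x)‖ ≤ C₀‖x‖⁻¹` and `‖V₀ x‖ ≤ C₀‖x‖⁻¹` for `t < 0`, `x ≠ 0`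
  (`traceWeakLimit_norm_slice_le`, `traceWeakLimit_norm_trace_le`), so
  `‖V(t, x) − V₀ x‖² ≤ 4C₀² ‖x‖⁻²`, an envelope integrable on balls of `ℝ³`
  (`NewtonPotentialHolder.integrableOn_ball_norm_rpow_neg`, exponent `2 < 3`); the integrands are
  a.e. strongly measurable (continuous slices, a.e. strongly measurable trace,
  `traceWeakLimit_aestronglyMeasurable`) and converge to `0` at every `x ≠ 0` (the origin is
  Lebesgue-null); dominated convergence along the countably generated filter `𝓝[<] 0`
  (`tendsto_integral_filter_of_dominated_convergence`) for the measure restricted to the ball.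
* `‖V₀ x‖² ≤ C₀² ‖x‖⁻²` a.e., whence `‖V₀‖² ∈ L¹(B_r)` (`Integrable.mono'`).
* Dissipation: Pineau–Vicol, Lemma 7.1 with `n = 1` (`traceC1_slice_bounds`) gives
  `‖DV(t, x)‖ ≤ K₁ max(‖x‖, √(−t))⁻²`; the elementary bound `max(a, b)⁻⁴ ≤ b^{−3/2} a^{−5/2}`
  (`a, b > 0`) yields `‖DV(t, x)‖² ≤ K₁² (−t)^{−3/4} ‖x‖^{−5/2}` for `t < 0`, `x ≠ 0`, i.e. a.e. on
  `(−r², 0) × B_r` for the product of the restricted measures (`Measure.prod_restrict`); Tonelli for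
  a product function (`lintegral_prod_mul`), `∫_{−r²}^{0} (−t)^{−3/4} dt < ∞`
  (`intervalIntegral.intervalIntegrable_rpow'`, exponent `−3/4 > −1`, reflected by `t ↦ −t`) and
  `∫_{B_r} ‖x‖^{−5/2} dx < ∞` (`NewtonPotentialHolder.lintegral_ball_norm_rpow_neg`, `5/2 < 3`).
-/

noncomputable section

-- the summit namespace `…NavierStokesRegularity.NavierStokesRegularity…` is the tree convention (D-0017)
set_option linter.dupNamespace false

namespace Summit.NavierStokesRegularity.NavierStokesRegularity.Theorems.PolyhedralDssProfileExists.PolyhedralCell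

open MeasureTheory Set Function Filter Topology Metric
open Literature.Analysis Literature.Analysis.FluidPDE
open scoped ENNReal

section NoEnergyConcentration

variable {V : ℝ → EuclideanSpace ℝ (Fin 3) → EuclideanSpace ℝ (Fin 3)} {C C₀ : ℝ}
  {V₀ : EuclideanSpace ℝ (Fin 3) → EuclideanSpace ℝ (Fin 3)}

/-- **No energy concentration**: `∫_{B_r} ‖V(t) − V₀‖² → 0` as `t ↑ 0` (dominated convergence
along `𝓝[<] 0` for the measure restricted to the ball, with the integrable envelope
`4C₀² ‖x‖⁻²`; the integrands vanish in the limit at every `x ≠ 0`). -/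
theorem noEnergyConcentration_tendsto (hV : IsTypeIAncientMild C V) (hD : HasTypeIDecay C₀ V)
    (hT : ∀ x, x ≠ 0 → Tendsto (fun t => V t x) (𝓝[<] 0) (𝓝 (V₀ x))) (r : ℝ) :
    Tendsto (fun t => ∫ x in ball (0 : EuclideanSpace ℝ (Fin 3)) r, ‖V t x - V₀ x‖ ^ 2)
      (𝓝[<] 0) (𝓝 0) := by
  have hm : AEStronglyMeasurable V₀ volume := traceWeakLimit_aestronglyMeasurable hV hT
  have h := tendsto_integral_filter_of_dominated_convergence
    (μ := volume.restrict (ball (0 : EuclideanSpace ℝ (Fin 3)) r)) (l := 𝓝[<] (0 : ℝ))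
    (F := fun t x => ‖V t x - V₀ x‖ ^ 2) (f := fun _ => (0 : ℝ))
    (fun x => (2 * C₀) ^ 2 * ‖x‖ ^ (-(2 : ℝ))) ?_ ?_ ?_ ?_
  · simpa only [integral_zero] using h
  · filter_upwards [self_mem_nhdsWithin] with t ht
    exact ((continuous_norm.pow 2).comp_aestronglyMeasurable
      ((hV.continuous_slice ht).aestronglyMeasurable.sub hm)).restrict
  · filter_upwards [self_mem_nhdsWithin] with t ht
    filter_upwards [ae_restrict_of_ae traceWeakLimit_ae_ne_zero] with x hx
    rw [norm_pow, norm_norm]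
    have hxn : 0 < ‖x‖ := norm_pos_iff.2 hx
    have hle : ‖V t x - V₀ x‖ ≤ 2 * C₀ * ‖x‖⁻¹ :=
      (norm_sub_le _ _).trans (by
        linarith [traceWeakLimit_norm_slice_le hD ht hx, traceWeakLimit_norm_trace_le hD hT hx])
    calc ‖V t x - V₀ x‖ ^ 2 ≤ (2 * C₀ * ‖x‖⁻¹) ^ 2 := pow_le_pow_left₀ (norm_nonneg _) hle 2
      _ = (2 * C₀) ^ 2 * ‖x‖ ^ (-(2 : ℝ)) := by
        rw [mul_pow, Real.rpow_neg hxn.le, Real.rpow_two, inv_pow]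
  · exact (NewtonPotentialHolder.integrableOn_ball_norm_rpow_neg (s := 2) (by norm_num) r).const_mul
      _
  · filter_upwards [ae_restrict_of_ae traceWeakLimit_ae_ne_zero] with x hx
    have h2 := ((hT x hx).sub_const (V₀ x)).norm.pow 2
    rwa [sub_self, norm_zero, zero_pow two_ne_zero] at h2

/-- **The trace has locally finite energy**: `‖V₀‖² ∈ L¹(B_r)` (a.e. strongly measurable and
dominated by the integrable envelope `C₀² ‖x‖⁻²`). -/
theorem noEnergyConcentration_integrableOn_sq (hV : IsTypeIAncientMild C V)
    (hD : HasTypeIDecay C₀ V)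
    (hT : ∀ x, x ≠ 0 → Tendsto (fun t => V t x) (𝓝[<] 0) (𝓝 (V₀ x))) (r : ℝ) :
    IntegrableOn (fun x => ‖V₀ x‖ ^ 2) (ball (0 : EuclideanSpace ℝ (Fin 3)) r) volume := by
  refine Integrable.mono'
    ((NewtonPotentialHolder.integrableOn_ball_norm_rpow_neg (s := 2) (by norm_num) r).const_mul
      (C₀ ^ 2))
    ((continuous_norm.pow 2).comp_aestronglyMeasurable
      (traceWeakLimit_aestronglyMeasurable hV hT)).restrict ?_
  filter_upwards [ae_restrict_of_ae traceWeakLimit_ae_ne_zero] with x hx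
  rw [norm_pow, norm_norm]
  have hxn : 0 < ‖x‖ := norm_pos_iff.2 hx
  calc ‖V₀ x‖ ^ 2 ≤ (C₀ * ‖x‖⁻¹) ^ 2 :=
        pow_le_pow_left₀ (norm_nonneg _) (traceWeakLimit_norm_trace_le hD hT hx) 2
    _ = C₀ ^ 2 * ‖x‖ ^ (-(2 : ℝ)) := by rw [mul_pow, Real.rpow_neg hxn.le, Real.rpow_two, inv_pow]

/-- The elementary bound `max(a, b)⁻⁴ ≤ b^{−3/2} a^{−5/2}` for `a, b > 0`
(`b^{3/2} a^{5/2} ≤ max^{3/2} max^{5/2} = max⁴`). -/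
theorem noEnergyConcentration_max_inv_pow_le {a b : ℝ} (ha : 0 < a) (hb : 0 < b) :
    ((max a b)⁻¹ ^ 2) ^ 2 ≤ b ^ (-(3 / 2 : ℝ)) * a ^ (-(5 / 2 : ℝ)) := by
  have hm : 0 < max a b := lt_max_of_lt_left ha
  have key : b ^ (3 / 2 : ℝ) * a ^ (5 / 2 : ℝ) ≤ (max a b) ^ (4 : ℕ) := by
    calc b ^ (3 / 2 : ℝ) * a ^ (5 / 2 : ℝ)
        ≤ (max a b) ^ (3 / 2 : ℝ) * (max a b) ^ (5 / 2 : ℝ) :=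
          mul_le_mul (Real.rpow_le_rpow hb.le (le_max_right _ _) (by norm_num))
            (Real.rpow_le_rpow ha.le (le_max_left _ _) (by norm_num)) (by positivity)
            (by positivity)
      _ = (max a b) ^ ((4 : ℕ) : ℝ) := by rw [← Real.rpow_add hm]; norm_num
      _ = (max a b) ^ (4 : ℕ) := Real.rpow_natCast _ _
  calc ((max a b)⁻¹ ^ 2) ^ 2 = ((max a b) ^ 4)⁻¹ := by rw [← pow_mul, inv_pow]
    _ ≤ (b ^ (3 / 2 : ℝ) * a ^ (5 / 2 : ℝ))⁻¹ := inv_anti₀ (by positivity) key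
    _ = b ^ (-(3 / 2 : ℝ)) * a ^ (-(5 / 2 : ℝ)) := by
        rw [mul_inv, Real.rpow_neg hb.le, Real.rpow_neg ha.le]

/-- The pointwise dissipation bound in `ℝ≥0∞`: from `‖DV(t, x)‖ ≤ K₁ max(‖x‖, √(−t))⁻²`,
`‖DV(t, x)‖ₑ² ≤ K₁² · (−t)^{−3/4} · ‖x‖^{−5/2}` for `t < 0`, `x ≠ 0`
(`noEnergyConcentration_max_inv_pow_le` with `a = ‖x‖`, `b = √(−t)`, `√(−t)^{−3/2} = (−t)^{−3/4}`). -/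
theorem noEnergyConcentration_enorm_fderiv_sq_le {K₁ : ℝ}
    (hK : ∀ t < 0, ∀ y, ‖fderiv ℝ (V t) y‖ ≤ K₁ * (max ‖y‖ (Real.sqrt (-t)))⁻¹ ^ 2)
    {t : ℝ} (ht : t < 0) {x : EuclideanSpace ℝ (Fin 3)} (hx : x ≠ 0) :
    ‖fderiv ℝ (V t) x‖ₑ ^ 2 ≤ ENNReal.ofReal (K₁ ^ 2) *
      (ENNReal.ofReal ((-t) ^ (-(3 / 4 : ℝ))) * ENNReal.ofReal (‖x‖ ^ (-(5 / 2 : ℝ)))) := by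
  have hxn : 0 < ‖x‖ := norm_pos_iff.2 hx
  have ht0 : 0 ≤ -t := by linarith
  have hb : 0 < Real.sqrt (-t) := Real.sqrt_pos.2 (by linarith)
  have hsq : Real.sqrt (-t) ^ (-(3 / 2 : ℝ)) = (-t) ^ (-(3 / 4 : ℝ)) := by
    rw [Real.sqrt_eq_rpow, ← Real.rpow_mul ht0]
    norm_num
  have h1 : ‖fderiv ℝ (V t) x‖ ^ 2 ≤ K₁ ^ 2 * ((-t) ^ (-(3 / 4 : ℝ)) * ‖x‖ ^ (-(5 / 2 : ℝ))) :=
    calc ‖fderiv ℝ (V t) x‖ ^ 2 ≤ (K₁ * (max ‖x‖ (Real.sqrt (-t)))⁻¹ ^ 2) ^ 2 :=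
          pow_le_pow_left₀ (norm_nonneg _) (hK t ht x) 2
      _ = K₁ ^ 2 * ((max ‖x‖ (Real.sqrt (-t)))⁻¹ ^ 2) ^ 2 := mul_pow _ _ _
      _ ≤ K₁ ^ 2 * (Real.sqrt (-t) ^ (-(3 / 2 : ℝ)) * ‖x‖ ^ (-(5 / 2 : ℝ))) :=
          mul_le_mul_of_nonneg_left (noEnergyConcentration_max_inv_pow_le hxn hb) (sq_nonneg _)
      _ = K₁ ^ 2 * ((-t) ^ (-(3 / 4 : ℝ)) * ‖x‖ ^ (-(5 / 2 : ℝ))) := by rw [hsq]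
  calc ‖fderiv ℝ (V t) x‖ₑ ^ 2 = ENNReal.ofReal (‖fderiv ℝ (V t) x‖ ^ 2) := by
        rw [← ofReal_norm, ENNReal.ofReal_pow (norm_nonneg _)]
    _ ≤ ENNReal.ofReal (K₁ ^ 2 * ((-t) ^ (-(3 / 4 : ℝ)) * ‖x‖ ^ (-(5 / 2 : ℝ)))) :=
        ENNReal.ofReal_le_ofReal h1
    _ = _ := by rw [ENNReal.ofReal_mul (sq_nonneg _), ENNReal.ofReal_mul (Real.rpow_nonneg ht0 _)]

/-- `t ↦ (−t)^{−3/4}` is integrable on `(−r², 0)` (`s ↦ s^{−3/4}` is interval integrable on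
`[0, r²]`, exponent `−3/4 > −1`; reflect by `t ↦ −t`). -/
theorem noEnergyConcentration_integrableOn_time (r : ℝ) :
    IntegrableOn (fun t : ℝ => (-t) ^ (-(3 / 4 : ℝ))) (Ioo (-r ^ 2) 0) volume := by
  have h3 : IntervalIntegrable (fun s : ℝ => s ^ (-(3 / 4 : ℝ))) volume 0 (r ^ 2) :=
    intervalIntegral.intervalIntegrable_rpow' (by norm_num)
  rw [IntervalIntegrable.iff_comp_neg, neg_zero] at h3
  have h4 := h3.symm
  rw [intervalIntegrable_iff_integrableOn_Ioo_of_le (neg_nonpos.2 (sq_nonneg r))] at h4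
  exact h4

/-- **Finite local dissipation near the singular point**:
`∫_{(−r², 0) × B_r} ‖DV‖² < ∞` (a.e. bound `‖DV(t, x)‖ₑ² ≤ K₁² (−t)^{−3/4} ‖x‖^{−5/2}` on the
product of the restricted measures, Tonelli for the product function, and finiteness of the two
factors). -/
theorem noEnergyConcentration_dissipation_lt_top (hV : IsTypeIAncientMild C V)
    (hD : HasTypeIDecay C₀ V) {r : ℝ} (hr : 0 < r) :
    (∫⁻ z in Ioo (-r ^ 2) 0 ×ˢ ball (0 : EuclideanSpace ℝ (Fin 3)) r,
        ‖fderiv ℝ (V z.1) z.2‖ₑ ^ 2) < ⊤ := by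
  obtain ⟨K₁, K₂, -, -, hK⟩ := traceC1_slice_bounds hV hD
  set μS : Measure ℝ := volume.restrict (Ioo (-r ^ 2) 0) with hμS
  set νB : Measure (EuclideanSpace ℝ (Fin 3)) := volume.restrict (ball 0 r) with hνB
  have hprod : (volume : Measure (ℝ × EuclideanSpace ℝ (Fin 3))).restrict
      (Ioo (-r ^ 2) 0 ×ˢ ball 0 r) = μS.prod νB := by
    rw [Measure.volume_eq_prod, Measure.prod_restrict]
  rw [hprod]
  -- the a.e. bound on the product of the restricted measures
  have h1 : ∀ᵐ z ∂(μS.prod νB), z.1 ∈ Ioo (-r ^ 2) 0 :=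
    (Measure.quasiMeasurePreserving_fst (μ := μS) (ν := νB)).ae (ae_restrict_mem measurableSet_Ioo)
  have h2 : ∀ᵐ z ∂(μS.prod νB), z.2 ≠ 0 :=
    (Measure.quasiMeasurePreserving_snd (μ := μS) (ν := νB)).ae
      (ae_restrict_of_ae traceWeakLimit_ae_ne_zero)
  have hbound : ∀ᵐ z ∂(μS.prod νB), ‖fderiv ℝ (V z.1) z.2‖ₑ ^ 2 ≤ ENNReal.ofReal (K₁ ^ 2) *
      (ENNReal.ofReal ((-z.1) ^ (-(3 / 4 : ℝ))) * ENNReal.ofReal (‖z.2‖ ^ (-(5 / 2 : ℝ)))) := by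
    filter_upwards [h1, h2] with z hz1 hz2
    exact noEnergyConcentration_enorm_fderiv_sq_le (fun t ht y => (hK t ht y).1) hz1.2 hz2
  -- the two factors are finite
  have hS : (∫⁻ t, ENNReal.ofReal ((-t) ^ (-(3 / 4 : ℝ))) ∂μS) < ⊤ :=
    (noEnergyConcentration_integrableOn_time r).setLIntegral_lt_top
  have hB : (∫⁻ x, ENNReal.ofReal (‖x‖ ^ (-(5 / 2 : ℝ))) ∂νB) < ⊤ := by
    rw [hνB, NewtonPotentialHolder.lintegral_ball_norm_rpow_neg (by norm_num) hr]
    exact ENNReal.ofReal_lt_top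
  have hfm : AEMeasurable (fun t : ℝ => ENNReal.ofReal ((-t) ^ (-(3 / 4 : ℝ)))) μS :=
    (measurable_neg.pow_const _).ennreal_ofReal.aemeasurable
  have hgm : AEMeasurable
      (fun x : EuclideanSpace ℝ (Fin 3) => ENNReal.ofReal (‖x‖ ^ (-(5 / 2 : ℝ)))) νB :=
    (measurable_norm.pow_const _).ennreal_ofReal.aemeasurable
  calc (∫⁻ z, ‖fderiv ℝ (V z.1) z.2‖ₑ ^ 2 ∂(μS.prod νB))
      ≤ ∫⁻ z, ENNReal.ofReal (K₁ ^ 2) * (ENNReal.ofReal ((-z.1) ^ (-(3 / 4 : ℝ))) *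
          ENNReal.ofReal (‖z.2‖ ^ (-(5 / 2 : ℝ)))) ∂(μS.prod νB) := lintegral_mono_ae hbound
    _ = ENNReal.ofReal (K₁ ^ 2) * ((∫⁻ t, ENNReal.ofReal ((-t) ^ (-(3 / 4 : ℝ))) ∂μS) *
          ∫⁻ x, ENNReal.ofReal (‖x‖ ^ (-(5 / 2 : ℝ))) ∂νB) := by
        rw [lintegral_const_mul' _ _ ENNReal.ofReal_ne_top]
        congr 1
        exact lintegral_prod_mul hfm hgm
    _ < ⊤ := ENNReal.mul_lt_top ENNReal.ofReal_lt_top (ENNReal.mul_lt_top hS hB)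

end NoEnergyConcentration

/-- **Stub `stub_noEnergyConcentration` (N35): a Type-I singularity does not concentrate energy;
its local dissipation is finite.** For a Type-I ancient mild field `V` in the Oseen gauge with
`HasTypeIDecay C₀ V` and pointwise trace `V₀` off the origin, for every `r > 0`:
`∫_{B_r} ‖V(t) − V₀‖² → 0` as `t ↑ 0` (`noEnergyConcentration_tendsto`: dominated convergence with
the envelope `4C₀²‖x‖⁻² ∈ L¹(B_r)`), `‖V₀‖² ∈ L¹(B_r)` (`noEnergyConcentration_integrableOn_sq`), and
`∫_{−r²}^{0}∫_{B_r} ‖DV‖² < ∞` (`noEnergyConcentration_dissipation_lt_top`: PV Lemma 7.1,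
`max(a,b)⁻⁴ ≤ a^{−5/2} b^{−3/2}`, Tonelli). -/
theorem stub_noEnergyConcentration :
    ∀ (V : ℝ → EuclideanSpace ℝ (Fin 3) → EuclideanSpace ℝ (Fin 3)) (C C₀ : ℝ)
      (V₀ : EuclideanSpace ℝ (Fin 3) → EuclideanSpace ℝ (Fin 3)),
      IsTypeIAncientMild C V → HasTypeIDecay C₀ V →
      (∀ x, x ≠ 0 → Tendsto (fun t => V t x) (𝓝[<] 0) (𝓝 (V₀ x))) →
      (∀ r : ℝ, 0 < r →
        Tendsto (fun t => ∫ x in Metric.ball (0 : EuclideanSpace ℝ (Fin 3)) r, ‖V t x - V₀ x‖ ^ 2) (𝓝[<] 0) (𝓝 0)) ∧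
      (∀ r : ℝ, 0 < r → IntegrableOn (fun x => ‖V₀ x‖ ^ 2) (Metric.ball (0 : EuclideanSpace ℝ (Fin 3)) r) volume) ∧
      (∀ r : ℝ, 0 < r →
        (∫⁻ z in Set.Ioo (-r ^ 2) 0 ×ˢ Metric.ball (0 : EuclideanSpace ℝ (Fin 3)) r,
            ‖fderiv ℝ (V z.1) z.2‖ₑ ^ 2) < ⊤) :=
  fun _ _ _ _ hV hD hT =>
    ⟨fun r _ => noEnergyConcentration_tendsto hV hD hT r,
      fun r _ => noEnergyConcentration_integrableOn_sq hV hD hT r,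
      fun _ hr => noEnergyConcentration_dissipation_lt_top hV hD hr⟩

end Summit.NavierStokesRegularity.NavierStokesRegularity.Theorems.PolyhedralDssProfileExists.PolyhedralCell
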